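import Summits.QuantumFields.YangMills.Theorems.UnitScaleTiltProp7LandauTransversalityMargin
import Summits.QuantumFields.YangMills.Theorems.UnitScaleTiltProp7TwistedSliceGaugeOntoSU2Letters
import HarnessLib

/-!
# Route `UnitScaleTilt`, crux K1 child «MinimiserStabilityRegPr» (stmt-QuantumFields-19200), skeleton v10, stub `stub_existenceMinimalOrbit` (EX), route (α) —
# **(P2-core) IN `hSplitD`'s REAL CURRENCY FROM THE PAIRING TEST: the `𝔰𝔲(2)` twin of ✓`Prop7LandauTransversalityMargin.hcore_of_pairing`** — the hypothesis `hcore` of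
# ✓`Prop7LandauTransversalityReduction.hSplitP2_su2_of_core` (σ′ `𝔰𝔲(2)`-valued, `N′` Hermitian traceless) from the SAME complex pairing test, by extracting the `𝔰𝔲(2)`-component of
# the complex solution along `M₂(ℂ) = 𝔰𝔲(2) ⊕ i·𝔰𝔲(2) ⊕ ℂ·1` (★w4-20520's θ-engine ✓`Prop7TwistedSliceGaugeOntoSU2Letters.eq_zero_of_su2_add_I_smul_su2_add_smul_one`) under DISPLAYED
# sector rows for the four operators involved (`T`, the pulled gauge direction `M⁻¹Gd`, the restricted Landau divergence `R_S D*_{U₀}`, `Δ^η_{U₀}`) and the `𝔰𝔲(2)` chart-preimage row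
# (✓R1b `exists_su2_kerQTwS_of_sliceTangent`'s shape).

Cell `ym3-torus`, width seat `ym-ust-20520-w5` (gen 7).  THEOREMS ONLY (0 `def`, 0 `sorry`).  `--supports stmt-QuantumFields-19200 --as helper`, count-neutral.  YM₃ on T³ is a
ladder rung (R3), not the Clay problem; nothing here claims the stub, the crux, d = 4 or the mass gap.

THE ARGUMENT.  The complex proof (✓`hcore_of_pairing`) produces `N′` with `T(M⁻¹Gd N′) = 0` and `R_S D*_{U₀}(M⁻¹Gd N′) = Δ^η_{U₀} l`.  Write `N′ = N₁ + i·N₂ + n·1` (Hermitian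
traceless parts, scalar part), so `M⁻¹Gd N′ = w₁ + i·w₂ + w₀` with `w₁, w₂` `𝔰𝔲(2)`-valued and `w₀` central (rows `hGsu`, `hGsc`).  Both equations split along the three sectors
(rows `hTsu`∕`hTsc` for `T`, `hLsu`∕`hLsc` for `R_S D*`, `hΔsu` for `Δ^η l` with `l` `𝔰𝔲(2)`-valued): `T w₁ = 0` and `R_S D* w₁ = Δ^η l`.  The `𝔰𝔲(2)` chart-preimage row gives
`δ₀` `𝔰𝔲(2)`-valued with `Qδ₀ = 0`, `Dδ₀ = w₁`; `δ₀ = w₁ − H(Q w₁)` (✓`eq_sub_H_of_QTwS_eq_zero`) so `R_S D*δ₀ = Δ^η l` by `h45L`; `σ′ := D_{U₀}l − δ₀` is `𝔰𝔲(2)`-valued, in the slice,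
and `M(D(D_{U₀}l)) = M(Dσ′) + Gd N₁`.

WHAT IS PROVED (sorry-free, no definition; ns `…Theorems.Prop7LandauTransversalityMargin`):
* §1 `decomp_su2` — `Z = h₀(Z) + i·k₀(Z) + (tr Z∕2)·1` with `h₀, k₀` Hermitian traceless (pointwise, `M₂(ℂ)`); `su2_of_decomp_eq` — sector extraction for functions.
* §1 `gaugeDir_su2` — `toL2⁻¹(D_{U₀}(toL2S l))` is `𝔰𝔲(2)`-valued for `𝔰𝔲(2)`-valued `l` (stencil ✓`DL2_apply`, `U₀(b) ∈ SU(2)`).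
* §2 ★★★`hcore_su2_of_pairing` — the `hcore` hypothesis of ✓`hSplitP2_su2_of_core` VERBATIM, from: the binders of ✓`hcore_of_pairing` (`hQH hDH h45L M hM Gd htest`; `hTD`∕`hDsurj` not needed), the
  `𝔰𝔲(2)` chart-preimage row `hsu2pre`, and the sector rows `hGsu hGsc hTsu hTsc hLsu hLsc hΔsu` (all DISPLAYED; inhabitability: `hGsu`∕`hGsc` for `M b := gSer ℂ (ad ℂ (−χ(A′) b))`,
  `Gd N b := i·N(b₋) − U′(b)(i·N(b₊))U′(b)⋆` by ✓`star_gSer_ad_apply`∕✓`trace_gSer_ad_apply_eq`∕✓`gSer_ad_apply_smul_one` + unitarity; `hTsu`∕`hTsc` = ✓`fderiv_logChartTwS_su2`∕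
  ✓`fderiv_logChartTwS_central` (✓`towerRows_at_of_regPr`); `hsu2pre` = ✓`exists_su2_kerQTwS_of_sliceTangent`; `hLsu`∕`hLsc`∕`hΔsu` = reality + sector rows of `R_S`, `D*_{U₀}`, `Δ^η_{U₀}`
  (✓`RS_comm`, ✓`DstarL2_star_comm`, ✓`covLapSite_star_comm`, ✓`trace_DstarL2_apply_eq_zero`, the reflection engine of ✓`Prop7GaugeSliceDecomposition.exists_slice_add_gaugeDir_skew`) —
  their discharge at the chart point is the sequel).
HONEST SCOPE.  Exact bookkeeping; no estimate; nothing of print asserted; no stub ∕ crux statement advanced.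

References: T. Bałaban, CMP 99 (1985) 389–434 [Balaban1985BackgroundPropagators] ((3.3) p.391, (3.8) p.392, (3.20)–(3.23) p.394, (3.115) p.418); CMP 102 (1985) 277–309
[Balaban1985Variational] ((45) p.285, (47)–(51) pp.285–286, (82)–(83) p.290).
-/

set_option autoImplicit false

noncomputable section

open scoped InnerProductSpace Matrix.Norms.L2Operator Matrix
open Filter Metric

namespace Summit.QuantumFields.YangMills.Theorems.Prop7LandauTransversalityMargin

open Literature.MathematicalPhysics.QuantumFieldTheory.Balaban1983to89
open Literature.MathematicalPhysics.QuantumFieldTheory.Balaban1983to89.T3ContinuumYM3Torus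
open Literature.MathematicalPhysics.QuantumFieldTheory.Balaban1983to89.T3SectALandauChart (eta eta_pos)
open B11Eq103H1Complex (SiteL2K BondL2K)
open Summit.QuantumFields.YangMills.Theorems.Prop7SectET3Transport (periodsT3 bondEquiv bgOfCfg val_bgOfCfg isUnitaryBg_bgOfCfg)
open Summit.QuantumFields.YangMills.Theorems.Prop7SymAvgTwSym (QTwS)
open Summit.QuantumFields.YangMills.Theorems.Prop7SectET3HilbertLetters (W₂ toL2 toL2S toL2B QL2 DL2 DstarL2 covLapSite QL2_toL2 adjoint_DL2 DL2_apply)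
open Summit.QuantumFields.YangMills.Theorems.Prop7SectET3GaugeProjector (NS RS RSPi DstarPi RSPi_apply DstarPi_apply QL2_DL2_eq_zero_of_mem_NS RS_isSymmetric
  RS_apply_covLapSite_of_mem RS_RS RS_apply_eq_self_iff)
open Summit.QuantumFields.YangMills.Theorems.Prop7SPrint (IsLandauPrintS)
open Summit.QuantumFields.YangMills.Theorems.Prop7TwistedSliceGaugeOntoSU2 (eq_zero_of_su2_add_I_smul_su2_add_smul_one)

/-! ## §1 The decomposition `M₂(ℂ) = 𝔰𝔲(2) ⊕ i·𝔰𝔲(2) ⊕ ℂ·1` for functions, and the `𝔰𝔲(2)` gauge direction -/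

/-- Scalar bookkeeping: `tr 1 = 2` on `M₂(ℂ)`. [folklore] -/
theorem trace_one_fin_two : Matrix.trace (1 : Matrix (Fin 2) (Fin 2) ℂ) = 2 := by
  rw [Matrix.trace_one, Fintype.card_fin]; norm_num

/-- **THE THREE-SECTOR DECOMPOSITION OF A `2×2` MATRIX**: `Z = a + i·b + s·1` with `a, b` skew-Hermitian traceless and `s = tr Z∕2` (`a := ½(Z₀ − Z₀⋆)`, `b := (−i∕2)(Z₀ + Z₀⋆)`,
`Z₀ := Z − s·1`; ★w4-20520's θ-bookkeeping). [folklore] -/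
theorem decomp_su2 (Z : Matrix (Fin 2) (Fin 2) ℂ) :
    ∃ a b : Matrix (Fin 2) (Fin 2) ℂ, (star a = -a ∧ a.trace = 0) ∧ (star b = -b ∧ b.trace = 0) ∧
      Z = a + Complex.I • b + ((2 : ℂ)⁻¹ * Z.trace) • (1 : Matrix (Fin 2) (Fin 2) ℂ) := by
  have htrstar : ∀ X : Matrix (Fin 2) (Fin 2) ℂ, (star X).trace = star X.trace := fun X => by
    rw [Matrix.star_eq_conjTranspose, Matrix.trace_conjTranspose]
  have h2 : star ((2 : ℂ)⁻¹) = (2 : ℂ)⁻¹ := by rw [Complex.star_def, map_inv₀, map_ofNat]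
  set s : ℂ := (2 : ℂ)⁻¹ * Z.trace with hs
  set Zt : Matrix (Fin 2) (Fin 2) ℂ := Z - s • (1 : Matrix (Fin 2) (Fin 2) ℂ) with hZt
  have hZt_tr : Zt.trace = 0 := by
    simp only [hZt, hs, Matrix.trace_sub, Matrix.trace_smul, trace_one_fin_two, smul_eq_mul]; ring
  refine ⟨(2 : ℂ)⁻¹ • (Zt - star Zt), (-(Complex.I * (2 : ℂ)⁻¹)) • (Zt + star Zt), ⟨?_, ?_⟩, ⟨?_, ?_⟩, ?_⟩
  · rw [star_smul, h2, star_sub, star_star, ← smul_neg, neg_sub]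
  · rw [Matrix.trace_smul, Matrix.trace_sub, htrstar, hZt_tr, star_zero, sub_zero, smul_zero]
  · have hc : star (-(Complex.I * (2 : ℂ)⁻¹)) = -(-(Complex.I * (2 : ℂ)⁻¹)) := by
      rw [star_neg, star_mul', h2, Complex.star_def, Complex.conj_I, neg_mul]
    rw [star_smul, star_add, star_star, add_comm (star Zt) Zt, hc, neg_smul]
  · rw [Matrix.trace_smul, Matrix.trace_add, htrstar, hZt_tr, star_zero, add_zero, smul_zero]
  · have hI : Complex.I * -(Complex.I * (2 : ℂ)⁻¹) = (2 : ℂ)⁻¹ := by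
      rw [mul_neg, ← mul_assoc, Complex.I_mul_I, neg_mul, neg_neg, one_mul]
    rw [smul_smul, hI]
    have hZ : Z = Zt + s • (1 : Matrix (Fin 2) (Fin 2) ℂ) := by rw [hZt, sub_add_cancel]
    nth_rewrite 1 [hZ]
    module

/-- **SECTOR EXTRACTION FOR FUNCTIONS**: if `A + i·B + c·1 = S` pointwise with `A, B, S` `𝔰𝔲(2)`-valued and `c` scalar, then `A = S` (✓`eq_zero_of_su2_add_I_smul_su2_add_smul_one`
at `A − S`). [folklore] -/
theorem su2_of_decomp_eq {ι : Type*} {A B S : ι → Matrix (Fin 2) (Fin 2) ℂ} {c : ι → ℂ}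
    (hA : ∀ x, star (A x) = -A x ∧ (A x).trace = 0) (hB : ∀ x, star (B x) = -B x ∧ (B x).trace = 0) (hS : ∀ x, star (S x) = -S x ∧ (S x).trace = 0)
    (h : ∀ x, A x + Complex.I • B x + c x • (1 : Matrix (Fin 2) (Fin 2) ℂ) = S x) : A = S := by
  funext x
  have hAS : star (A x - S x) = -(A x - S x) ∧ (A x - S x).trace = 0 :=
    ⟨by rw [star_sub, (hA x).1, (hS x).1, neg_sub_neg, neg_sub], by rw [Matrix.trace_sub, (hA x).2, (hS x).2, sub_zero]⟩
  have h0 : (A x - S x) + Complex.I • B x + c x • (1 : Matrix (Fin 2) (Fin 2) ℂ) = 0 := by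
    rw [sub_add_eq_add_sub, sub_add_eq_add_sub, h x, sub_self]
  exact sub_eq_zero.1 (eq_zero_of_su2_add_I_smul_su2_add_smul_one hAS (hB x) h0).1

variable (F : T3Family) {n K : ℕ} (h : n ≤ K)

/-- **THE `U₀`-GAUGE DIRECTION OF AN `𝔰𝔲(2)` PARAMETER IS `𝔰𝔲(2)`-VALUED**: `toL2⁻¹(D_{U₀}(toL2S l))(b) = η⁻¹(U₀(b)l(b₊)U₀(b)⋆ − l(b₋))` (✓`DL2_apply`) is skew-Hermitian traceless
when `l` is (`U₀(b) ∈ SU(2)`, `η` real). [cite: Balaban1985BackgroundPropagators, (3.3) p.391, (3.5) p.391] -/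
theorem gaugeDir_su2 {c₀ : ℝ} [Fact (0 < c₀)] (U₀ : GaugeField (F.P K) 0 (Matrix.specialUnitaryGroup (Fin 2) ℂ)) {l : Site (F.P K) 0 → Matrix (Fin 2) (Fin 2) ℂ}
    (hl : ∀ x, star (l x) = -l x ∧ (l x).trace = 0) (b : PBond (F.P K) 0) :
    star ((toL2 F K c₀).symm (DL2 F n K c₀ U₀ (toL2S F K c₀ l)) b) = -(toL2 F K c₀).symm (DL2 F n K c₀ U₀ (toL2S F K c₀ l)) b ∧
      ((toL2 F K c₀).symm (DL2 F n K c₀ U₀ (toL2S F K c₀ l)) b).trace = 0 := by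
  have hinv : ((((bgOfCfg F K U₀ (bondEquiv F K b))⁻¹ : (Matrix (Fin 2) (Fin 2) ℂ)ˣ) : Matrix (Fin 2) (Fin 2) ℂ)) =
      star (((U₀ b : Matrix.specialUnitaryGroup (Fin 2) ℂ) : Matrix (Fin 2) (Fin 2) ℂ)) := by
    rw [isUnitaryBg_bgOfCfg, val_bgOfCfg, Equiv.symm_apply_apply]
  have hUU : star (((U₀ b : Matrix.specialUnitaryGroup (Fin 2) ℂ) : Matrix (Fin 2) (Fin 2) ℂ)) * ((U₀ b : Matrix.specialUnitaryGroup (Fin 2) ℂ) : Matrix (Fin 2) (Fin 2) ℂ) = 1 :=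
    Matrix.mem_unitaryGroup_iff'.1 (U₀ b).2.1
  have hη : star ((((eta F n K : ℝ) : ℂ))⁻¹) = (((eta F n K : ℝ) : ℂ))⁻¹ := by rw [Complex.star_def, map_inv₀, Complex.conj_ofReal]
  rw [DL2_apply, hinv]
  refine ⟨?_, ?_⟩
  · rw [star_smul, hη, star_sub, star_mul, star_mul, star_star, (hl b.tgt).1, (hl b.src).1, ← smul_neg]
    congr 1
    noncomm_ring
  · rw [Matrix.trace_smul, Matrix.trace_sub, Matrix.trace_mul_cycle, hUU, one_mul, (hl b.tgt).2, (hl b.src).2, sub_zero, smul_zero]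

/-! ## §2 The `𝔰𝔲(2)` twin of `hcore_of_pairing` -/

/-- ★★★ **(P2-core) IN THE REAL CURRENCY FROM THE PAIRING TEST.**  Binders of ✓`hcore_of_pairing` (`hQH hDH h45L M hM Gd htest`; `T ∘L D = Q(U₀)` and `D` onto are NOT needed here — the `𝔰𝔲(2)`
chart-preimage row replaces them) plus: the `𝔰𝔲(2)` chart-preimage row
`hsu2pre` (✓`exists_su2_kerQTwS_of_sliceTangent`'s shape: an `𝔰𝔲(2)`-valued `β ∈ ker T` is `Dδ₀`, `δ₀` `𝔰𝔲(2)`-valued in `ker Q(U₀)`), and the SECTOR ROWS of the pulled gauge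
direction (`hGsu`: Hermitian-traceless `N` ↦ `𝔰𝔲(2)`-valued `M⁻¹Gd N`; `hGsc`: scalar `N` ↦ central), of `T` (`hTsu`, `hTsc`), of the restricted Landau divergence `R_S(U₀)D*_{U₀}` read on
the route carriers (`hLsu`, `hLsc`) and of `Δ^η_{U₀}` (`hΔsu`).  THEN the `hcore` hypothesis of ✓`hSplitP2_su2_of_core` holds VERBATIM: for every `𝔰𝔲(2)`-valued residual `l` the pushed
gauge direction is `M(Dσ′) + Gd N′` with `σ′` `𝔰𝔲(2)`-valued in the linear slice and `N′` Hermitian traceless.  Proof: the complex solution `N′` of ✓`hcore_of_pairing`'s Hilbert step,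
decomposed along `M₂(ℂ) = 𝔰𝔲(2) ⊕ i·𝔰𝔲(2) ⊕ ℂ·1`; its Hermitian-traceless component `N₁` still solves both equations (sector extraction); `δ₀ := D⁻¹(M⁻¹Gd N₁)` is `𝔰𝔲(2)`-valued by
`hsu2pre` and Landau by `δ₀ = w₁ − H(Qw₁)` + `h45L`; `σ′ := D_{U₀}l − δ₀`.
[cite: Balaban1985BackgroundPropagators, (3.3) p.391, (3.8) p.392, (3.20)–(3.23) p.394, (3.115) p.418; Balaban1985Variational, (45) p.285, (47)–(51) pp.285–286, (82)–(83) p.290] -/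
theorem hcore_su2_of_pairing {c₀ cB : ℝ} [Fact (0 < c₀)] [Fact (0 < cB)] (U₀ : GaugeField (F.P K) 0 (Matrix.specialUnitaryGroup (Fin 2) ℂ))
    {T : (PBond (F.P K) 0 → Matrix (Fin 2) (Fin 2) ℂ) →L[ℂ] (PBond (F.P n) 0 → Matrix (Fin 2) (Fin 2) ℂ)}
    {D : (PBond (F.P K) 0 → Matrix (Fin 2) (Fin 2) ℂ) →L[ℂ] (PBond (F.P K) 0 → Matrix (Fin 2) (Fin 2) ℂ)}
    {H : (PBond (F.P n) 0 → Matrix (Fin 2) (Fin 2) ℂ) →ₗ[ℂ] (PBond (F.P K) 0 → Matrix (Fin 2) (Fin 2) ℂ)} (hQH : ∀ X, QTwS F n K h U₀ (H X) = X)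
    (hDH : ∀ v : PBond (F.P K) 0 → Matrix (Fin 2) (Fin 2) ℂ, ∃ y, v - D v = H y) (h45L : ∀ Y, IsLandauPrintS F n K h c₀ cB U₀ (H Y))
    (M : PBond (F.P K) 0 → (Matrix (Fin 2) (Fin 2) ℂ →L[ℂ] Matrix (Fin 2) (Fin 2) ℂ)) (hM : ∀ b, Function.Bijective (M b))
    (Gd : (Site (F.P K) 0 → Matrix (Fin 2) (Fin 2) ℂ) →ₗ[ℂ] (PBond (F.P K) 0 → Matrix (Fin 2) (Fin 2) ℂ))
    (htest : ∀ l : Site (F.P K) 0 → Matrix (Fin 2) (Fin 2) ℂ, toL2S F K c₀ l ∈ NS F n K h c₀ cB U₀ →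
      covLapSite F n K c₀ U₀ (toL2S F K c₀ l) ≠ 0 →
      ∃ (N' : Site (F.P K) 0 → Matrix (Fin 2) (Fin 2) ℂ) (w : PBond (F.P K) 0 → Matrix (Fin 2) (Fin 2) ℂ),
        (∀ b, M b (w b) = Gd N' b) ∧ T w = 0 ∧ ⟪toL2 F K c₀ w, DL2 F n K c₀ U₀ (covLapSite F n K c₀ U₀ (toL2S F K c₀ l))⟫_ℂ ≠ 0)
    (hsu2pre : ∀ β : PBond (F.P K) 0 → Matrix (Fin 2) (Fin 2) ℂ, (∀ b, star (β b) = -β b ∧ (β b).trace = 0) → T β = 0 →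
      ∃ δ₀ : PBond (F.P K) 0 → Matrix (Fin 2) (Fin 2) ℂ, (∀ b, star (δ₀ b) = -δ₀ b ∧ (δ₀ b).trace = 0) ∧ QTwS F n K h U₀ δ₀ = 0 ∧ D δ₀ = β)
    (hGsu : ∀ (N : Site (F.P K) 0 → Matrix (Fin 2) (Fin 2) ℂ) (w : PBond (F.P K) 0 → Matrix (Fin 2) (Fin 2) ℂ),
      (∀ x, (N x).IsHermitian ∧ (N x).trace = 0) → (∀ b, M b (w b) = Gd N b) → ∀ b, star (w b) = -w b ∧ (w b).trace = 0)
    (hGsc : ∀ (c : Site (F.P K) 0 → ℂ) (w : PBond (F.P K) 0 → Matrix (Fin 2) (Fin 2) ℂ),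
      (∀ b, M b (w b) = Gd (fun x => c x • (1 : Matrix (Fin 2) (Fin 2) ℂ)) b) → ∀ b, ∃ z : ℂ, w b = z • (1 : Matrix (Fin 2) (Fin 2) ℂ))
    (hTsu : ∀ w : PBond (F.P K) 0 → Matrix (Fin 2) (Fin 2) ℂ, (∀ b, star (w b) = -w b ∧ (w b).trace = 0) → ∀ c, star (T w c) = -T w c ∧ (T w c).trace = 0)
    (hTsc : ∀ w : PBond (F.P K) 0 → Matrix (Fin 2) (Fin 2) ℂ, (∀ b, ∃ z : ℂ, w b = z • (1 : Matrix (Fin 2) (Fin 2) ℂ)) → ∀ c, ∃ z : ℂ, T w c = z • (1 : Matrix (Fin 2) (Fin 2) ℂ))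
    (hLsu : ∀ Y : PBond (F.P K) 0 → Matrix (Fin 2) (Fin 2) ℂ, (∀ b, star (Y b) = -Y b ∧ (Y b).trace = 0) →
      ∀ x, star (RSPi F n K h c₀ cB U₀ (DstarPi F n K c₀ U₀ Y) x) = -RSPi F n K h c₀ cB U₀ (DstarPi F n K c₀ U₀ Y) x ∧ (RSPi F n K h c₀ cB U₀ (DstarPi F n K c₀ U₀ Y) x).trace = 0)
    (hLsc : ∀ Y : PBond (F.P K) 0 → Matrix (Fin 2) (Fin 2) ℂ, (∀ b, ∃ z : ℂ, Y b = z • (1 : Matrix (Fin 2) (Fin 2) ℂ)) →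
      ∀ x, ∃ z : ℂ, RSPi F n K h c₀ cB U₀ (DstarPi F n K c₀ U₀ Y) x = z • (1 : Matrix (Fin 2) (Fin 2) ℂ))
    (hΔsu : ∀ l : Site (F.P K) 0 → Matrix (Fin 2) (Fin 2) ℂ, (∀ x, star (l x) = -l x ∧ (l x).trace = 0) →
      ∀ x, star ((toL2S F K c₀).symm (covLapSite F n K c₀ U₀ (toL2S F K c₀ l)) x) = -(toL2S F K c₀).symm (covLapSite F n K c₀ U₀ (toL2S F K c₀ l)) x ∧
        ((toL2S F K c₀).symm (covLapSite F n K c₀ U₀ (toL2S F K c₀ l)) x).trace = 0) :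
    ∀ l : Site (F.P K) 0 → Matrix (Fin 2) (Fin 2) ℂ, (∀ x, star (l x) = -l x ∧ (l x).trace = 0) → toL2S F K c₀ l ∈ NS F n K h c₀ cB U₀ →
      ∃ σ' : PBond (F.P K) 0 → Matrix (Fin 2) (Fin 2) ℂ, (∀ b', star (σ' b') = -σ' b' ∧ (σ' b').trace = 0) ∧ QTwS F n K h U₀ σ' = 0 ∧ IsLandauPrintS F n K h c₀ cB U₀ σ' ∧
        ∃ N' : Site (F.P K) 0 → Matrix (Fin 2) (Fin 2) ℂ, (∀ x, (N' x).IsHermitian ∧ (N' x).trace = 0) ∧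
          ∀ b, M b (D ((toL2 F K c₀).symm (DL2 F n K c₀ U₀ (toL2S F K c₀ l))) b) = M b (D σ' b) + Gd N' b := by
  intro l hlR hl
  -- the bondwise inverse velocity maps and `X := M⁻¹Gd` (as in the complex proof)
  let Me : PBond (F.P K) 0 → (Matrix (Fin 2) (Fin 2) ℂ ≃ₗ[ℂ] Matrix (Fin 2) (Fin 2) ℂ) := fun b =>
    LinearEquiv.ofBijective ((M b : Matrix (Fin 2) (Fin 2) ℂ →L[ℂ] Matrix (Fin 2) (Fin 2) ℂ) : Matrix (Fin 2) (Fin 2) ℂ →ₗ[ℂ] Matrix (Fin 2) (Fin 2) ℂ) (hM b)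
  have hMe : ∀ b x, Me b x = M b x := fun b x => rfl
  have hMsymm : ∀ b y, M b ((Me b).symm y) = y := fun b y => by rw [← hMe, LinearEquiv.apply_symm_apply]
  let X : (Site (F.P K) 0 → Matrix (Fin 2) (Fin 2) ℂ) →ₗ[ℂ] (PBond (F.P K) 0 → Matrix (Fin 2) (Fin 2) ℂ) :=
    LinearMap.pi fun b => (Me b).symm.toLinearMap ∘ₗ LinearMap.proj b ∘ₗ Gd
  have hX : ∀ N' b, X N' b = (Me b).symm (Gd N' b) := fun N' b => rfl
  have hMX : ∀ N' b, M b (X N' b) = Gd N' b := fun N' b => by rw [hX, hMsymm]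
  let 𝒩 : Submodule ℂ (Site (F.P K) 0 → Matrix (Fin 2) (Fin 2) ℂ) := LinearMap.ker (T.toLinearMap ∘ₗ X)
  let Λ : 𝒩 →ₗ[ℂ] SiteL2K ℂ 3 (periodsT3 F K) c₀ W₂ :=
    (RS F n K h c₀ cB U₀ ∘ₗ DstarL2 F n K c₀ U₀ ∘ₗ (toL2 F K c₀).toLinearMap ∘ₗ X) ∘ₗ 𝒩.subtype
  have hΛ : ∀ v : 𝒩, Λ v = RS F n K h c₀ cB U₀ (DstarL2 F n K c₀ U₀ (toL2 F K c₀ (X (v : Site (F.P K) 0 → Matrix (Fin 2) (Fin 2) ℂ)))) := fun v => rfl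
  have hΛfix : ∀ v : 𝒩, RS F n K h c₀ cB U₀ (Λ v) = Λ v := fun v => by rw [hΛ, RS_RS]
  have htest' : ∀ f : SiteL2K ℂ 3 (periodsT3 F K) c₀ W₂, RS F n K h c₀ cB U₀ f = f → f ≠ 0 → ∃ v : 𝒩, ⟪Λ v, f⟫_ℂ ≠ 0 := by
    intro f hf hf0
    obtain ⟨l₁, hl₁, rfl⟩ := (RS_apply_eq_self_iff U₀ f).1 hf
    have hl₁' : toL2S F K c₀ ((toL2S F K c₀).symm l₁) ∈ NS F n K h c₀ cB U₀ := by rwa [LinearEquiv.apply_symm_apply]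
    have hf0' : covLapSite F n K c₀ U₀ (toL2S F K c₀ ((toL2S F K c₀).symm l₁)) ≠ 0 := by rwa [LinearEquiv.apply_symm_apply]
    obtain ⟨N', w, hMw, hTw, hpair⟩ := htest _ hl₁' hf0'
    rw [LinearEquiv.apply_symm_apply] at hpair
    have hwX : w = X N' := by
      funext b
      rw [hX, LinearEquiv.eq_symm_apply, hMe]
      exact hMw b
    have hN' : N' ∈ 𝒩 := by
      rw [LinearMap.mem_ker, LinearMap.comp_apply, ContinuousLinearMap.coe_coe, ← hwX, hTw]
    refine ⟨⟨N', hN'⟩, ?_⟩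
    rw [hΛ, Submodule.coe_mk, ← hwX, RS_isSymmetric U₀, RS_apply_covLapSite_of_mem U₀ hl₁, ← adjoint_DL2, LinearMap.adjoint_inner_left]
    exact hpair
  have hmem : covLapSite F n K c₀ U₀ (toL2S F K c₀ l) ∈ LinearMap.range Λ :=
    mem_range_of_pairing (RS F n K h c₀ cB U₀) Λ hΛfix htest' _ (RS_apply_covLapSite_of_mem U₀ hl)
  obtain ⟨v, hv⟩ := LinearMap.mem_range.1 hmem
  rw [hΛ] at hv
  set N' : Site (F.P K) 0 → Matrix (Fin 2) (Fin 2) ℂ := (v : Site (F.P K) 0 → Matrix (Fin 2) (Fin 2) ℂ) with hN'def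
  have hTN' : T (X N') = 0 := by
    have := v.2
    rw [LinearMap.mem_ker, LinearMap.comp_apply, ContinuousLinearMap.coe_coe] at this
    exact this
  -- the restricted Landau divergence read on the route carriers
  have hLdef : ∀ Y : PBond (F.P K) 0 → Matrix (Fin 2) (Fin 2) ℂ,
      RSPi F n K h c₀ cB U₀ (DstarPi F n K c₀ U₀ Y) = (toL2S F K c₀).symm (RS F n K h c₀ cB U₀ (DstarL2 F n K c₀ U₀ (toL2 F K c₀ Y))) := fun Y => by
    rw [RSPi_apply, DstarPi_apply, LinearEquiv.apply_symm_apply]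
  have hLN' : RSPi F n K h c₀ cB U₀ (DstarPi F n K c₀ U₀ (X N')) = (toL2S F K c₀).symm (covLapSite F n K c₀ U₀ (toL2S F K c₀ l)) := by rw [hLdef, hv]
  -- decompose `N′ = N₁ + i·N₂ + n·1`
  choose a b hab using fun x => decomp_su2 (N' x)
  set N₁ : Site (F.P K) 0 → Matrix (Fin 2) (Fin 2) ℂ := fun x => Complex.I • b x with hN₁
  set N₂ : Site (F.P K) 0 → Matrix (Fin 2) (Fin 2) ℂ := fun x => (-Complex.I) • a x with hN₂
  set nn : Site (F.P K) 0 → ℂ := fun x => (2 : ℂ)⁻¹ * (N' x).trace with hnn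
  have hN₁R : ∀ x, (N₁ x).IsHermitian ∧ (N₁ x).trace = 0 := fun x => by
    refine ⟨?_, ?_⟩
    · show (Complex.I • b x)ᴴ = Complex.I • b x
      rw [Matrix.conjTranspose_smul, ← Matrix.star_eq_conjTranspose, (hab x).2.1.1, Complex.star_def, Complex.conj_I, smul_neg, neg_smul, neg_neg]
    · show (Complex.I • b x).trace = 0
      rw [Matrix.trace_smul, (hab x).2.1.2, smul_zero]
  have hN₂R : ∀ x, (N₂ x).IsHermitian ∧ (N₂ x).trace = 0 := fun x => by
    refine ⟨?_, ?_⟩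
    · show ((-Complex.I) • a x)ᴴ = (-Complex.I) • a x
      rw [Matrix.conjTranspose_smul, ← Matrix.star_eq_conjTranspose, (hab x).1.1, star_neg, Complex.star_def, Complex.conj_I, neg_neg, smul_neg, neg_smul]
    · show ((-Complex.I) • a x).trace = 0
      rw [Matrix.trace_smul, (hab x).1.2, smul_zero]
  have hN'dec : N' = N₁ + Complex.I • N₂ + fun x => nn x • (1 : Matrix (Fin 2) (Fin 2) ℂ) := by
    funext x
    simp only [Pi.add_apply, Pi.smul_apply, hN₁, hN₂, hnn, smul_smul, mul_neg, Complex.I_mul_I, neg_neg, one_smul]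
    conv_lhs => rw [(hab x).2.2]
    abel
  set w₁ := X N₁ with hw₁
  set w₂ := X N₂ with hw₂
  set w₀ := X (fun x => nn x • (1 : Matrix (Fin 2) (Fin 2) ℂ)) with hw₀
  have hXdec : X N' = w₁ + Complex.I • w₂ + w₀ := by rw [hN'dec, map_add, map_add, map_smul]
  have hw₁R : ∀ b', star (w₁ b') = -w₁ b' ∧ (w₁ b').trace = 0 := hGsu N₁ w₁ hN₁R (hMX N₁)
  have hw₂R : ∀ b', star (w₂ b') = -w₂ b' ∧ (w₂ b').trace = 0 := hGsu N₂ w₂ hN₂R (hMX N₂)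
  have hw₀c : ∀ b', ∃ z : ℂ, w₀ b' = z • (1 : Matrix (Fin 2) (Fin 2) ℂ) := hGsc nn w₀ (hMX _)
  -- sector extraction for `T`: `T w₁ = 0`
  have hTw₁ : T w₁ = 0 := by
    choose z hz using hTsc w₀ hw₀c
    have hsum : ∀ c, T w₁ c + Complex.I • T w₂ c + z c • (1 : Matrix (Fin 2) (Fin 2) ℂ) = (0 : PBond (F.P n) 0 → Matrix (Fin 2) (Fin 2) ℂ) c := by
      intro c
      have := congrArg (fun Y : PBond (F.P n) 0 → Matrix (Fin 2) (Fin 2) ℂ => Y c) hTN'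
      rw [hXdec, map_add, map_add, map_smul] at this
      simpa only [Pi.add_apply, Pi.smul_apply, hz c, Pi.zero_apply] using this
    exact su2_of_decomp_eq (hTsu w₁ hw₁R) (hTsu w₂ hw₂R) (fun c => by simp) hsum
  -- sector extraction for the Landau divergence: `R_S D* w₁ = Δ^η l`
  have hLw₁ : RSPi F n K h c₀ cB U₀ (DstarPi F n K c₀ U₀ w₁) = (toL2S F K c₀).symm (covLapSite F n K c₀ U₀ (toL2S F K c₀ l)) := by
    choose z hz using hLsc w₀ hw₀c
    have hsum : ∀ x, RSPi F n K h c₀ cB U₀ (DstarPi F n K c₀ U₀ w₁) x + Complex.I • RSPi F n K h c₀ cB U₀ (DstarPi F n K c₀ U₀ w₂) x + z x • (1 : Matrix (Fin 2) (Fin 2) ℂ)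
        = (toL2S F K c₀).symm (covLapSite F n K c₀ U₀ (toL2S F K c₀ l)) x := by
      intro x
      have := congrArg (fun Y : Site (F.P K) 0 → Matrix (Fin 2) (Fin 2) ℂ => Y x) hLN'
      rw [hXdec, map_add, map_add, map_add, map_add, map_smul, map_smul] at this
      simpa only [Pi.add_apply, Pi.smul_apply, hz x] using this
    exact su2_of_decomp_eq (hLsu w₁ hw₁R) (hLsu w₂ hw₂R) (hΔsu l hlR) hsum
  -- the 𝔰𝔲(2) preimage under the chart derivative
  obtain ⟨δ₀, hδ₀R, hQδ₀, hDδ₀⟩ := hsu2pre w₁ hw₁R hTw₁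
  have hδ₀eq : δ₀ = w₁ - H (QTwS F n K h U₀ w₁) := eq_sub_H_of_QTwS_eq_zero F h U₀ hQH hDH hDδ₀ hQδ₀
  -- the slice vector
  set g : PBond (F.P K) 0 → Matrix (Fin 2) (Fin 2) ℂ := (toL2 F K c₀).symm (DL2 F n K c₀ U₀ (toL2S F K c₀ l)) with hgdef
  have hQg : QTwS F n K h U₀ g = 0 := by
    have h1 : QL2 F n K h c₀ cB U₀ (toL2 F K c₀ g) = 0 := by
      rw [hgdef, LinearEquiv.apply_symm_apply, QL2_DL2_eq_zero_of_mem_NS U₀ hl]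
    rw [QL2_toL2] at h1
    exact (toL2B F n cB).injective (by rw [h1, map_zero])
  have hLg : RSPi F n K h c₀ cB U₀ (DstarPi F n K c₀ U₀ g) = (toL2S F K c₀).symm (covLapSite F n K c₀ U₀ (toL2S F K c₀ l)) := by
    rw [hLdef, hgdef, LinearEquiv.apply_symm_apply]
    have hΔ : DstarL2 F n K c₀ U₀ (DL2 F n K c₀ U₀ (toL2S F K c₀ l)) = covLapSite F n K c₀ U₀ (toL2S F K c₀ l) := rfl
    rw [hΔ, RS_apply_covLapSite_of_mem U₀ hl]
  have h45L' : ∀ Y, RSPi F n K h c₀ cB U₀ (DstarPi F n K c₀ U₀ (H Y)) = 0 := fun Y => h45L Y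
  refine ⟨g - δ₀, fun b' => ⟨?_, ?_⟩, by rw [map_sub, hQg, hQδ₀, sub_zero], ?_, N₁, hN₁R, fun b' => ?_⟩
  · rw [Pi.sub_apply, star_sub, (gaugeDir_su2 F U₀ hlR b').1, (hδ₀R b').1, neg_sub_neg, neg_sub]
  · rw [Pi.sub_apply, Matrix.trace_sub, (gaugeDir_su2 F U₀ hlR b').2, (hδ₀R b').2, sub_zero]
  · show RSPi F n K h c₀ cB U₀ (DstarPi F n K c₀ U₀ (g - δ₀)) = 0
    rw [map_sub, map_sub, hδ₀eq, map_sub, map_sub, h45L', sub_zero, hLg, hLw₁, sub_self]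
  · rw [map_sub, Pi.sub_apply, map_sub, hDδ₀, hw₁, hMX, sub_add_cancel]

end Summit.QuantumFields.YangMills.Theorems.Prop7LandauTransversalityMargin

end
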